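import Summits.Schanuel.Schanuel.Theorems.RootDecomp1KGapCell02

/-!
# RootDecomp1KGapCell — lens 1, generation 42 «GAP CELL / INTERLACED SPECIALISATION» (lane K-R26 (α-loc)): the walls (1, ℓ_b, ρ), (1, ℓ₂, ℓ₃, ρ) (mod hNW), their π-twins and the 31077 pair (ℓ_b, ρ) HYPOTHESIS-FREE for every ρ ∈ `FactorialGapLiouville` — located order data strictly below the log-log floor; member ρ_W — continuation (RootDecomp1KGapCell03): §2 THE GAP ENGINE `algebraicIndependent_gap_of_mvPolyMeasure`

(lens-1 g42 `GapCell.lean` EDITION 3 [HOME/decomp-schanuel-lens-1/g42/ sha256 6f7828b1…, 2470 l; VERDICT L2004, EDITIONS 2+3 L2018, ACK L2023]; port by census-1 gen 17 as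
`RootDecomp1KGapCell01`–`10` — see the PORT NOTE of part 01; `--supports stmt-Schanuel-33364` (04: `stmt-Schanuel-31077`); rung 0.)
-/

open Summit.Schanuel.Schanuel.Theorems.RootDecomp1KHyper
open Summit.Schanuel.Schanuel.Theorems.RootDecomp1KHyper.HyperCell
open Summit.Schanuel.Schanuel.Theorems.RootDecomp1KRelLiouvilleCell
open Summit.Schanuel.Schanuel.Theorems.RootDecomp1KLogLogCell
open Summit.Schanuel.Schanuel.Theorems.RootDecomp1KTwoBaseCell
open LiouvilleNumber
open scoped Nat

namespace Summit.Schanuel.Schanuel.Theorems.RootDecomp1KGapCell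

section Engine
variable {k n : ℕ}

/-- Upper bound for the tail in base `m ≥ 2`: `r_k ≤ 2·m^{-(k+1)!}` (tree twin: TwoBaseCell04 `remainder_le`). -/
private theorem remainder_le'' {m : ℝ} (hm : 2 ≤ m) (k : ℕ) : remainder m k ≤ 2 / m ^ (k + 1)! := by
  have m1 : (1 : ℝ) < m := by linarith
  have h := remainder_lt' k m1
  have hhalf : (1 : ℝ) / m ≤ 1 / 2 := one_div_le_one_div_of_le two_pos hm
  have hpos : (0 : ℝ) < 1 - 1 / m := by linarith
  have hinv : (1 - 1 / m)⁻¹ ≤ 2 := by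
    rw [inv_le_comm₀ hpos two_pos]
    linarith
  have hmk : (0 : ℝ) < 1 / m ^ (k + 1)! := by positivity
  calc remainder m k ≤ (1 - 1 / m)⁻¹ * (1 / m ^ (k + 1)!) := h.le
    _ ≤ 2 * (1 / m ^ (k + 1)!) := mul_le_mul_of_nonneg_right hinv hmk.le
    _ = 2 / m ^ (k + 1)! := by ring

/-- The final balance: the measure's lower bound `1 ≤ A₀ D^{τ+1} δ` contradicts `D ≤ Q^{d+1}`, `δ ≤ 3/Q^A`
(`A = (d+1)(τ+1) + (DW+1)`) and `3A₀ < Q`. -/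
theorem gap_balance_false {A₀ D δ Q : ℝ} {d τ DW A : ℕ} (hA₀0 : 0 ≤ A₀) (hD0 : 0 < D) (hδ0 : 0 ≤ δ)
    (hQ1 : 1 ≤ Q) (hA : A = (d + 1) * (τ + 1) + (DW + 1)) (h1 : 1 ≤ A₀ * D ^ (τ + 1) * δ)
    (hD_le : D ≤ Q ^ (d + 1)) (hδ_le : δ ≤ 3 / Q ^ A) (hQbig : 3 * A₀ < Q) : False := by
  have hQpos : 0 < Q := lt_of_lt_of_le one_pos hQ1
  set E : ℕ := (d + 1) * (τ + 1) with hE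
  have hDpow : D ^ (τ + 1) ≤ Q ^ E := by
    calc D ^ (τ + 1) ≤ (Q ^ (d + 1)) ^ (τ + 1) := pow_le_pow_left₀ hD0.le hD_le _
      _ = Q ^ E := by rw [← pow_mul]
  have hQA_split : Q ^ A = Q ^ E * Q ^ (DW + 1) := by rw [hA, pow_add]
  have hQdW : Q ≤ Q ^ (DW + 1) := by
    calc Q = Q ^ 1 := (pow_one Q).symm
      _ ≤ Q ^ (DW + 1) := pow_le_pow_right₀ hQ1 (by omega)
  have hQE0 : 0 < Q ^ E := pow_pos hQpos _
  have hQDW0 : 0 < Q ^ (DW + 1) := pow_pos hQpos _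
  have hkey : A₀ * D ^ (τ + 1) * δ ≤ 3 * A₀ / Q := by
    have hstep1 : A₀ * D ^ (τ + 1) * δ ≤ A₀ * Q ^ E * (3 / Q ^ A) :=
      mul_le_mul (mul_le_mul_of_nonneg_left hDpow hA₀0) hδ_le hδ0 (mul_nonneg hA₀0 hQE0.le)
    have hstep2 : A₀ * Q ^ E * (3 / Q ^ A) = 3 * A₀ / Q ^ (DW + 1) := by
      rw [hQA_split]
      field_simp
    have hstep3 : 3 * A₀ / Q ^ (DW + 1) ≤ 3 * A₀ / Q :=
      div_le_div_of_nonneg_left (by positivity) hQpos hQdW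
    linarith
  have hlt : 3 * A₀ / Q < 1 := (div_lt_one hQpos).mpr hQbig
  linarith

set_option maxHeartbeats 800000 in
/-- **THE GAP ENGINE.**  Bases `b_i ≥ 2` with injective monomial weights (tree `wt`, e.g. `b = (2)` or `(2,3)`), a
gap-Liouville real `ρ` (ORDER DATA ONLY), and a tuple `θ⃗` with a polynomial measure of algebraic independence in
every degree (`MvPolyMeasure θ`, tree): then `(ρ, ℓ_{b_1}, …, ℓ_{b_k}, θ_1, …, θ_n)` is algebraically independent
over `ℚ`.  Interlaced specialisation: the block at `s_N`, `ρ` at its gap approximant `r`; non-vanishing by the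
tree's lacunary lemma (block) and the tree's rational-root Lemma A (the gap `den r > 2^{A·N!}` beats every cleared
coefficient); NO induced measure of `(ℓ⃗, θ⃗)` is formed. -/
theorem algebraicIndependent_gap_of_mvPolyMeasure {b : Fin k → ℕ} (hb : ∀ i, 2 ≤ b i)
    (hinj : Function.Injective (wt b)) {ρ : ℝ} (hρ : FactorialGapLiouville ρ)
    {θ : Fin n → ℂ} (hθ : MvPolyMeasure θ) :
    AlgebraicIndependent ℚ
      (Sum.elim (Fin.cons (ρ : ℂ) (fun i => ((liouvilleNumber (b i) : ℝ) : ℂ)) : Fin (k + 1) → ℂ) θ :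
        Fin (k + 1) ⊕ Fin n → ℂ) := by
  classical
  refine algebraicIndependent_of_forall_int' fun P hP0 hPval => ?_
  -- bases
  have hbpos : ∀ i, 0 < b i := fun i => by have := hb i; omega
  have hb1 : ∀ i, (1 : ℝ) < b i := fun i => by exact_mod_cast (by have := hb i; omega : 1 < b i)
  have hb2 : ∀ i, (2 : ℝ) ≤ b i := fun i => by exact_mod_cast hb i
  set ℓ : Fin k → ℝ := fun i => liouvilleNumber (b i) with hℓ
  -- degree and measure
  set d : ℕ := P.totalDegree with hd
  obtain ⟨C, τ, hC, hmeas⟩ := hθ d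
  have hdeg : ∀ e ∈ P.support, ∑ x, e x ≤ d := fun e he => by
    have h1 := MvPolynomial.le_totalDegree he
    rwa [Finsupp.sum_fintype _ _ (fun _ => rfl)] at h1
  have hdegl : ∀ e ∈ P.support, ∀ i, e (Sum.inl i) ≤ d := fun e he i => by
    refine le_trans ?_ (hdeg e he)
    exact Finset.single_le_sum (f := fun x => e x) (fun _ _ => Nat.zero_le _) (Finset.mem_univ _)
  have hdegl1 : ∀ e ∈ P.support, ∀ i : Fin k, e (Sum.inl i.succ) ≤ d := fun e he i => hdegl e he i.succ
  have hdegL : ∀ e ∈ P.support, ∑ i, e (Sum.inl i) ≤ d := fun e he => by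
    refine le_trans ?_ (hdeg e he)
    rw [Fintype.sum_sum_type]; exact Nat.le_add_right _ _
  have hdegL' : ∀ e ∈ P.support, ∑ i : Fin k, e (Sum.inl i.succ) ≤ d := fun e he => by
    refine le_trans ?_ (hdegL e he)
    rw [Fin.sum_univ_succ]; exact Nat.le_add_left _ _
  have hdegT : ∀ e ∈ P.support, ∑ j, e (Sum.inr j) ≤ d := fun e he => by
    refine le_trans ?_ (hdeg e he)
    rw [Fintype.sum_sum_type]; exact Nat.le_add_left _ _
  -- (a) a support exponent `e₀` (θ-part `tpart e₀`, ρ-exponent `e₀ 0`); its block slice (§2a) is non-zero, so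
  -- by the tree's lacunary lemma its values at the truncations are eventually non-zero
  obtain ⟨e₀, he₀⟩ := MvPolynomial.support_nonempty.mpr hP0
  obtain ⟨N₀, hN₀⟩ := eventually_eval_partialSum_ne_zero hb hinj (blockSlice_ne_zero he₀)
  -- (b) constants
  set L : ℝ := ∑ e ∈ P.support, |((P.coeff e : ℤ) : ℝ)| with hL
  have hL0 : 0 ≤ L := Finset.sum_nonneg fun _ _ => abs_nonneg _
  set Rb : ℝ := 2 + |ρ| with hRb
  have hρabs : 0 ≤ |ρ| := abs_nonneg ρ
  have hRb2 : 2 ≤ Rb := by linarith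
  have hRb1 : 1 ≤ Rb := by linarith
  set R : ℝ := Rb + ∑ j, ‖θ j‖ with hR
  have hθsum : 0 ≤ ∑ j, ‖θ j‖ := Finset.sum_nonneg fun _ _ => norm_nonneg _
  have hR1 : 1 ≤ R := by linarith
  have hRbR : Rb ≤ R := by linarith
  have hθR : ∀ j, ‖θ j‖ ≤ R := fun j => by
    have : ‖θ j‖ ≤ ∑ j, ‖θ j‖ :=
      Finset.single_le_sum (f := fun j => ‖θ j‖) (fun _ _ => norm_nonneg _) (Finset.mem_univ j)
    linarith
  set W : ℕ := ∏ i, b i with hW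
  have hWpos : 0 < W := Finset.prod_pos fun i _ => hbpos i
  set DW : ℕ := d * W with hDW
  set A : ℕ := (d + 1) * (τ + 1) + (DW + 1) with hA
  set A₀ : ℝ := C * (Rb ^ d * L) ^ τ * (L * (d * R ^ d)) with hA₀
  have hA₀0 : 0 ≤ A₀ := by positivity
  -- (c) the threshold `K` (§2a), then the scale `N` and the gap approximant `r` from `hρ`
  obtain ⟨K, hKN₀, hKL, hKA⟩ := exists_threshold N₀ (L * 2 ^ d) (3 * A₀)
  obtain ⟨N, hKN, r, hF1, hF2, hF3⟩ := hρ A K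
  have hNN₀ : N₀ ≤ N := hKN₀.trans hKN
  have h2K : (2 : ℝ) ^ K ≤ 2 ^ N := pow_le_pow_right₀ (by norm_num) hKN
  have hNL : L * 2 ^ d ≤ 2 ^ N := hKL.trans h2K
  have hNA : 3 * A₀ < 2 ^ N := lt_of_lt_of_le hKA h2K
  -- the approximant `r = a / Q`
  set Q : ℝ := (r.den : ℝ) with hQ
  have hQpos : 0 < Q := by rw [hQ]; exact_mod_cast r.den_pos
  have hQ1 : 1 ≤ Q := by rw [hQ]; exact_mod_cast Nat.one_le_iff_ne_zero.mpr r.den_nz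
  set a : ℤ := r.num with ha
  have hr_eq : (r : ℝ) = (a : ℝ) / Q := by rw [hQ, ha, Rat.cast_def]
  have hQA0 : 0 < Q ^ A := pow_pos hQpos _
  have hQA1 : 1 / Q ^ A ≤ 1 := by
    rw [div_le_one hQA0]; exact one_le_pow₀ hQ1
  have hρr1 : |ρ - r| ≤ 1 := (hF3.le).trans hQA1
  have hr_abs : |(r : ℝ)| ≤ |ρ| + 1 := by
    have := abs_sub_abs_le_abs_sub (r : ℝ) ρ
    rw [abs_sub_comm] at this
    linarith
  have ha_abs : |(a : ℝ)| ≤ Rb * Q := by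
    have e1 : |(a : ℝ)| = |(r : ℝ)| * Q := by
      rw [hr_eq, abs_div, abs_of_pos hQpos, div_mul_cancel₀ _ hQpos.ne']
    rw [e1]
    refine mul_le_mul_of_nonneg_right ?_ hQpos.le
    linarith
  have hcop : IsCoprime a (r.den : ℤ) := by
    rw [Int.isCoprime_iff_gcd_eq_one, ha, Int.gcd_eq_natAbs, Int.natAbs_natCast]
    exact r.reduced
  -- (d) the truncations of the block `s_i = p_i / b_i^{N!}` and the tails
  have hps : ∀ i, ∃ p : ℕ, partialSum (b i : ℝ) N = p / ((b i ^ N ! : ℕ) : ℝ) :=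
    fun i => partialSum_eq_rat (hbpos i) N
  choose p hp using hps
  set s : Fin k → ℝ := fun i => partialSum (b i : ℝ) N with hs
  set Bq : Fin k → ℕ := fun i => b i ^ N ! with hBq
  have hBqpos : ∀ i, 0 < Bq i := fun i => pow_pos (hbpos i) _
  have hBqR : ∀ i, (0 : ℝ) < Bq i := fun i => by exact_mod_cast hBqpos i
  have hsp : ∀ i, s i = p i / Bq i := fun i => by rw [hs, hBq]; exact hp i
  have hp_lt : ∀ i, p i < 2 * Bq i := fun i => numerator_lt (hb i) (hp i)
  have hp_le : ∀ i, (p i : ℝ) ≤ 2 * Bq i := fun i => by exact_mod_cast (hp_lt i).le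
  have hs_pos : ∀ i, 0 < s i := fun i => partialSum_pos' (by linarith [hb1 i]) N
  have hs_lt : ∀ i, s i < 2 := fun i => partialSum_lt_two (hb2 i) N
  have hℓs : ∀ i, ℓ i - s i = remainder (b i) N := fun i => by
    have := partialSum_add_remainder (hb1 i) N; simp only [hℓ, hs]; linarith
  have hℓ_pos : ∀ i, 0 < ℓ i := fun i => by
    have := hℓs i; linarith [remainder_pos (hb1 i) N, hs_pos i]
  have hℓ_lt : ∀ i, ℓ i < 2 := fun i => by
    have := liouvilleNumber_le (hb2 i); simp only [hℓ]; linarith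
  have hdiff : ∀ i, |s i - ℓ i| ≤ 2 / (2 : ℝ) ^ (N + 1)! := fun i => by
    rw [abs_sub_comm, hℓs i, abs_of_pos (remainder_pos (hb1 i) N)]
    refine (remainder_le'' (hb2 i) N).trans ?_
    exact div_le_div_of_nonneg_left (by norm_num) (by positivity)
      (pow_le_pow_left₀ (by norm_num) (hb2 i) _)
  -- the block data as integers `pZ`, `BZ`, and `D_ℓ = ∏ B_i^d`
  set pZ : Fin k → ℤ := fun i => (p i : ℤ) with hpZ
  set BZ : Fin k → ℤ := fun i => (Bq i : ℤ) with hBZ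
  have hBZpos : ∀ i, (0 : ℝ) < BZ i := fun i => by simp only [hBZ]; exact_mod_cast hBqpos i
  have hspZ : ∀ i, s i = (pZ i : ℝ) / (BZ i : ℝ) := fun i => by
    simp only [hpZ, hBZ]; push_cast; exact hsp i
  have hpZ_abs : ∀ i, |(pZ i : ℝ)| ≤ 2 * BZ i := fun i => by
    simp only [hpZ, hBZ]; push_cast; rw [abs_of_nonneg (by positivity)]; exact hp_le i
  set Dl : ℝ := ∏ i : Fin k, ((BZ i : ℤ) : ℝ) ^ d with hDl
  have hDl0 : 0 < Dl := Finset.prod_pos fun i _ => pow_pos (hBZpos i) _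
  -- (d') the extended specialised side on `Fin (k+1)`: slot `0` is `ρ ↦ r`
  set s' : Fin (k + 1) → ℝ := Fin.cons (r : ℝ) s with hs'
  set ℓ' : Fin (k + 1) → ℝ := Fin.cons ρ ℓ with hℓ'
  set p' : Fin (k + 1) → ℤ := Fin.cons a pZ with hp'
  set B' : Fin (k + 1) → ℤ := Fin.cons (r.den : ℤ) BZ with hB'
  have hB'pos : ∀ i, (0 : ℝ) < B' i := fun i => by
    refine Fin.cases ?_ (fun j => ?_) i
    · simp only [hB', Fin.cons_zero]; exact_mod_cast r.den_pos
    · simp only [hB', Fin.cons_succ]; exact hBZpos j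
  have hsp' : ∀ i, s' i = (p' i : ℝ) / (B' i : ℝ) := fun i => by
    refine Fin.cases ?_ (fun j => ?_) i
    · simp only [hs', hp', hB', Fin.cons_zero]; push_cast; rw [hr_eq]
    · simp only [hs', hp', hB', Fin.cons_succ]; exact hspZ j
  have hp'_abs : ∀ i, |(p' i : ℝ)| ≤ Rb * B' i := fun i => by
    refine Fin.cases ?_ (fun j => ?_) i
    · simp only [hp', hB', Fin.cons_zero]; push_cast; rw [← hQ]; exact ha_abs
    · simp only [hp', hB', Fin.cons_succ]
      calc |(pZ j : ℝ)| ≤ 2 * BZ j := hpZ_abs j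
        _ ≤ Rb * BZ j := mul_le_mul_of_nonneg_right hRb2 (hBZpos j).le
  have hs'_abs : ∀ i, |s' i| ≤ Rb := fun i => by
    refine Fin.cases ?_ (fun j => ?_) i
    · simp only [hs', Fin.cons_zero]; linarith
    · simp only [hs', Fin.cons_succ]; rw [abs_of_pos (hs_pos j)]; linarith [hs_lt j]
  have hℓ'_abs : ∀ i, |ℓ' i| ≤ Rb := fun i => by
    refine Fin.cases ?_ (fun j => ?_) i
    · simp only [hℓ', Fin.cons_zero]; linarith
    · simp only [hℓ', Fin.cons_succ]; rw [abs_of_pos (hℓ_pos j)]; linarith [hℓ_lt j]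
  set δ : ℝ := 2 / (2 : ℝ) ^ (N + 1)! + 1 / Q ^ A with hδ
  have hQAinv : (0 : ℝ) ≤ 1 / Q ^ A := (div_pos one_pos hQA0).le
  have h2fac : (0 : ℝ) ≤ 2 / (2 : ℝ) ^ (N + 1)! := by positivity
  have hδ0 : 0 ≤ δ := by rw [hδ]; linarith
  have hdiff' : ∀ i, |s' i - ℓ' i| ≤ δ := fun i => by
    refine Fin.cases ?_ (fun j => ?_) i
    · simp only [hs', hℓ', Fin.cons_zero]
      rw [abs_sub_comm]
      linarith [hF3.le]
    · simp only [hs', hℓ', Fin.cons_succ]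
      linarith [hdiff j]
  -- (e) the integer polynomial `H = D · P(s', X)` in the `θ`-variables (§2a `clearPoly`): value, degree, length
  set H : MvPolynomial (Fin n) ℤ := clearPoly P d p' B' with hH
  set D : ℝ := ∏ i, ((B' i : ℤ) : ℝ) ^ d with hD
  have hD0 : 0 < D := Finset.prod_pos fun i _ => pow_pos (hB'pos i) _
  set xs : Fin (k + 1) ⊕ Fin n → ℂ := Sum.elim (fun i => ((s' i : ℝ) : ℂ)) θ with hxs
  set xl : Fin (k + 1) ⊕ Fin n → ℂ := Sum.elim (fun i => ((ℓ' i : ℝ) : ℂ)) θ with hxl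
  have hxl_eq : xl = Sum.elim (Fin.cons (ρ : ℂ) (fun i => ((liouvilleNumber (b i) : ℝ) : ℂ)) :
      Fin (k + 1) → ℂ) θ := by
    funext x
    rcases x with i | j
    · simp only [hxl, Sum.elim_inl]
      refine Fin.cases ?_ (fun i' => ?_) i
      · simp [hℓ']
      · simp [hℓ', hℓ]
    · simp [hxl]
  have hHval : MvPolynomial.aeval θ H = (D : ℂ) * MvPolynomial.aeval xs P :=
    aeval_clearPoly hdegl hB'pos hsp' θ
  have hHdeg : H.totalDegree ≤ d := totalDegree_clearPoly_le hdegT p' B'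
  have hHlen : (mvlen H : ℝ) ≤ Rb ^ d * D * L := mvlen_clearPoly_le hdegl hdegL hB'pos hRb1 hp'_abs
  have hHlen0 : (0 : ℝ) ≤ mvlen H := by exact_mod_cast mvlen_nonneg H
  -- (e3) THE GAP via the `ρ`-slices `κ_j` (§2a `sliceSum`): `κ_{j₀} = D_ℓ · q(s_N) ≠ 0` (lacunarity) and
  -- `|κ_j| ≤ L · 2^d · D_ℓ < den r` (the gap), so `H ≠ 0` by the tree's Lemma A (§2a `clearPoly_ne_zero_of_gap`)
  have hκ₀ne : sliceSum P d pZ BZ e₀ (e₀ (Sum.inl 0)) ≠ 0 := by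
    intro h0
    have h1 := sliceSum_self_cast hdegl1 hBZpos hspZ e₀
    rw [h0, Int.cast_zero] at h1
    rcases mul_eq_zero.mp h1.symm with h2 | h2
    · exact absurd h2 hDl0.ne'
    · exact hN₀ N hNN₀ h2
  have hDl_le : Dl ≤ (2 : ℝ) ^ (DW * N !) := by
    have hW2 : ((W : ℕ) : ℝ) ≤ 2 ^ W := by exact_mod_cast Nat.lt_two_pow_self.le
    have hDl_eq : Dl = ((W : ℕ) : ℝ) ^ (N ! * d) := by
      have h1 : ∀ i : Fin k, ((BZ i : ℤ) : ℝ) ^ d = ((b i : ℕ) : ℝ) ^ (N ! * d) := by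
        intro i; simp only [hBZ, hBq]; push_cast; rw [← pow_mul]
      rw [hDl, Finset.prod_congr rfl (fun i _ => h1 i), Finset.prod_pow, hW]
      push_cast; rfl
    rw [hDl_eq]
    calc ((W : ℕ) : ℝ) ^ (N ! * d) ≤ ((2 : ℝ) ^ W) ^ (N ! * d) :=
          pow_le_pow_left₀ (by positivity) hW2 _
      _ = (2 : ℝ) ^ (DW * N !) := by rw [← pow_mul, hDW]; congr 1; ring
  obtain ⟨hgap, hDl_ltQ⟩ : L * 2 ^ d * Dl < Q ∧ Dl < Q := gap_lt hNL hDl0 hDl_le (by omega) hF1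
  have hκ_lt : ∀ j, |sliceSum P d pZ BZ e₀ j| < (r.den : ℤ) := by
    intro j
    have h := (sliceSum_abs hdegl1 hdegL' hBZpos hpZ_abs e₀ j).trans_lt hgap
    rw [hQ] at h
    exact_mod_cast h
  have hH0 : H ≠ 0 := clearPoly_ne_zero_of_gap (fun e he => hdegl e he 0) he₀ hcop hκ₀ne hκ_lt
  -- (f) the measure at `H`
  have hM := hmeas H hH0 hHdeg
  rw [hHval, norm_mul, Complex.norm_real, Real.norm_eq_abs, abs_of_pos hD0] at hM
  -- (g) the Lipschitz upper bound `‖P(s', θ)‖ = ‖P(s', θ) − P(ℓ', θ)‖ ≤ L d R^d δ`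
  have hval0 : MvPolynomial.aeval xl P = 0 := by rw [hxl_eq]; exact hPval
  have hx : ∀ x, ‖xs x‖ ≤ R := by
    intro x; cases x with
    | inl i => simp only [hxs, Sum.elim_inl, Complex.norm_real, Real.norm_eq_abs]
               exact (hs'_abs i).trans hRbR
    | inr j => simp only [hxs, Sum.elim_inr]; exact hθR j
  have hy : ∀ x, ‖xl x‖ ≤ R := by
    intro x; cases x with
    | inl i => simp only [hxl, Sum.elim_inl, Complex.norm_real, Real.norm_eq_abs]
               exact (hℓ'_abs i).trans hRbR
    | inr j => simp only [hxl, Sum.elim_inr]; exact hθR j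
  have hxy : ∀ x, ‖xs x - xl x‖ ≤ δ := by
    intro x; cases x with
    | inl i => simp only [hxs, hxl, Sum.elim_inl]
               rw [← Complex.ofReal_sub, Complex.norm_real, Real.norm_eq_abs]; exact hdiff' i
    | inr j => simp only [hxs, hxl, Sum.elim_inr, sub_self, norm_zero]; exact hδ0
  have hLip := norm_aeval_sub_aeval_le P hR1 hδ0 hx hy hxy (le_refl d)
  rw [hval0, sub_zero] at hLip
  -- (h) combine: `1 ≤ A₀ · D^{τ+1} · δ` against `D ≤ Q^{d+1}`, `δ ≤ 3/Q^A`, `3A₀ < Q` (§2a `gap_balance_false`)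
  have h1 : (1 : ℝ) ≤ A₀ * D ^ (τ + 1) * δ := by
    have h1' : (1 : ℝ) ≤ C * (Rb ^ d * D * L) ^ τ * (D * (L * (d * R ^ d * δ))) := by
      calc (1 : ℝ) ≤ C * (mvlen H : ℝ) ^ τ * (D * ‖MvPolynomial.aeval xs P‖) := hM
        _ ≤ C * (Rb ^ d * D * L) ^ τ * (D * ‖MvPolynomial.aeval xs P‖) := by gcongr
        _ ≤ C * (Rb ^ d * D * L) ^ τ * (D * (L * (d * R ^ d * δ))) := by gcongr
    have h2 : C * (Rb ^ d * D * L) ^ τ * (D * (L * (d * R ^ d * δ))) = A₀ * D ^ (τ + 1) * δ := by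
      rw [hA₀]; ring
    exact h1'.trans_eq h2
  have hD_split : D = Q ^ d * Dl := by
    rw [hD, Fin.prod_univ_succ]
    simp only [hB', Fin.cons_zero, Fin.cons_succ, Int.cast_natCast, hQ, hDl]
  have hD_le : D ≤ Q ^ (d + 1) := by
    rw [hD_split, pow_succ]
    exact mul_le_mul_of_nonneg_left hDl_ltQ.le (by positivity)
  have hδ_le : δ ≤ 3 / Q ^ A := by
    have h2 : 2 / (2 : ℝ) ^ (N + 1)! ≤ 2 / Q ^ A :=
      div_le_div_of_nonneg_left (by norm_num) hQA0 hF2.le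
    rw [hδ]
    have : 2 / Q ^ A + 1 / Q ^ A = 3 / Q ^ A := by ring
    linarith
  have hQbig : 3 * A₀ < Q := by
    have h2 : (2 : ℝ) ^ N ≤ (2 : ℝ) ^ (A * N !) :=
      pow_le_pow_right₀ (by norm_num)
        ((Nat.self_le_factorial N).trans (Nat.le_mul_of_pos_left _ (by omega)))
    linarith
  exact gap_balance_false hA₀0 hD0 hδ0 hQ1 hA h1 hD_le hδ_le hQbig

end Engine

end Summit.Schanuel.Schanuel.Theorems.RootDecomp1KGapCell
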